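import Literature.NumberTheory.Transcendental.ZilberHomogeneityTransfer
import Literature.NumberTheory.Transcendental.ZilberClosedClass
import HarnessLib

/-!
# Zilber's categoricity theorem

B. Zilber, *Pseudo-exponentiation on algebraically closed fields of characteristic zero*, Ann.
Pure Appl. Logic 132 (2005) 67–95, Thm 1.1; complete proof: M. Bays, J. Kirby,
*Pseudo-exponential maps, variants, and quasiminimality*, Algebra & Number Theory 12 (2018)
493–549, Thm 1.2 = Thm 9.1, with M. Bays, J. Kirby, *Excellence and uncountable categoricity of
Zilber's exponential fields*, arXiv:1305.0493 (2013) (Props 4–5: Kirby's axioms 0–II for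
`ECF_{SK,CCP}`) and L. Haykazyan, *Categoricity in quasiminimal pregeometry classes*, J. Symbolic
Logic 81 (2016), Thm 16 (excellence is not needed): **two Zilber fields of the same uncountable
cardinality are isomorphic** — the named fact `zilber_categoricity` of `ZilberField.lean`. This
file PROVES it: `zilber_categoricity_holds`.

## The proof, as assembled in the tree

* Abstract half (Kirby, JSL 75 (2010), Thm 3.3 via BHHKK 2014; Haykazyan's Thm 16): in a
  quasiminimal pregeometry class (`Literature.ModelTheory.Quasiminimal.IsQuasiminimalPregeometryClass`,
  Haykazyan's Def. 2 with axiom II stated across two members), uncountable members of the same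
  cardinality are isomorphic — `IsQuasiminimalPregeometryClass.nonempty_equiv_of_mk_eq'`
  (`ClassCategoricity.lean`).
* The class (this file, after `ZilberClosedClass.lean`): fix one Zilber field's prime model
  `P = ecl(∅)`; members are exponential fields `H` (in the universe `Type u` of `P`) with a base point `ι_H : P → H`
  onto `ecl^H(∅)` and a closed embedding into an UNCOUNTABLE Zilber field, in the language
  `Language.eclIsoOver P` of `ZilberCategoricityOver.lean` (quantifier-free types = isomorphism
  types of pointed closures over the base points = Galois types over the prime model; Bays–Kirby
  2018, Remark 6.6, §8). Axioms (1) and (3) are elementary as before; axiom (2) holds because all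
  base points are onto `ecl(∅)`; axiom II over countable closed sets across two members is
  `ZilberTransfer.eclIsoOver_append_of_notMem` / `ZilberTransfer.exists_eclIsoOver_append_snoc`
  (`ZilberHomogeneityTransfer.lean`: transfer to the unique countable model of dimension `ℵ₀`,
  Bays–Kirby 2013 §2.4, Kirby 2013 (FPEF) Cor. 6.10, and Bays–Kirby 2018 Thm 6.9 there), and
  axiom II over `∅` is its special case `G = ecl(∅)`.
* Glue: two Zilber fields `K`, `K'` of the same uncountable cardinality are members for
  `P = ecl^K(∅)` (base point of `K'` from `ZilberPrimeModel.exists_eHom_eclEmpty`, Kirby 2013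
  Cor. 6.10 for dimension `0`), and an isomorphism of `Language.eclIsoOver P`-structures is an
  isomorphism of exponential fields.

Everything is proved; no named fact is introduced; net debt −1 (`zilber_categoricity`).

## References

* B. Zilber, Ann. Pure Appl. Logic 132 (2005) 67–95: Thm 1.1.
* M. Bays, J. Kirby, Algebra & Number Theory 12 (2018) 493–549, arXiv:1512.04262: Thm 1.2,
  Def. 6.1–6.3, Remark 6.6, Thm 6.9, §8, Thm 9.1.
* M. Bays, J. Kirby, arXiv:1305.0493 (2013): §2.4, Props 4–5.
* L. Haykazyan, J. Symbolic Logic 81 (2016) 56–64: Def. 2, Thm 16.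
* J. Kirby, J. Symbolic Logic 75 (2010) 551–564: Def. 1.1, Lemma 1.3, Thm 2.1, Thm 3.3.
* J. Kirby, Algebra & Number Theory 7 (2013): Cor. 6.10.
-/

noncomputable section

open Set Cardinal
open FirstOrder FirstOrder.Language
open Literature.ModelTheory.ExponentialFields Literature.ModelTheory.Quasiminimal

namespace Literature.NumberTheory.Transcendental

universe u

variable {P : Type u} [Field P] [ExponentialRing P]

/-! ### Partial embeddings carry `ecl`-dependence (base-point form) -/

section ClosureDeterminedOver

variable {K : Type u} [Field K] [ExponentialRing K] [EclBasePoint P K]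
  {K' : Type u} [Field K'] [ExponentialRing K'] [EclBasePoint P K']

/-- **Partial `Language.eclIsoOver P`-embeddings carry `ecl`-dependence** (one direction of Kirby
2010, axiom I.3, for exponential fields with base points; the base-point form of
`mem_ecl_range_iff_of_eqQFType₂_snoc`, available in every universe): if `(b, y)` and `(b', y')`
have the same quantifier-free type then `y ∈ ecl (range b) ↔ y' ∈ ecl (range b')` — the
isomorphism of pointed closures `ecl(b, y) ≅ ecl(b', y')` over `(b, y) ↦ (b', y')`
(`eclIsoOver_of_eqQFType₂`) maps `ecl(b)` onto `ecl(b')`. [cite: Kirby2010QMEC, Lemma 1.3] -/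
theorem mem_ecl_range_iff_of_eqQFType₂_snoc_over (hι : ∀ p, basePt P K p ∈ ecl (∅ : Set K))
    {n : ℕ} {b : Fin n → K} {b' : Fin n → K'} {y : K} {y' : K'}
    (h : (Language.eclIsoOver P).EqQFType₂ (Fin.snoc b y : Fin (n + 1) → K) (Fin.snoc b' y')) :
    y ∈ ecl (Set.range b) ↔ y' ∈ ecl (Set.range b') := by
  set t : Fin (n + 1) → K := Fin.snoc b y with ht
  set t' : Fin (n + 1) → K' := Fin.snoc b' y' with ht'
  obtain ⟨φ, hφ, hφt, -⟩ := eclIsoOver_of_eqQFType₂ hι h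
  have hφinj : Function.Injective φ := φ.toRingHom.injective
  have hbt : ∀ i, b i ∈ ecl (Set.range t) := fun i =>
    subset_ecl _ ⟨Fin.castSucc i, by simp [ht]⟩
  have hyt : y ∈ ecl (Set.range t) := subset_ecl _ ⟨Fin.last n, by simp [ht]⟩
  let b₀ : Fin n → Khovanskii.eclSubfield (Set.range t) := fun i => ⟨b i, hbt i⟩
  let y₀ : Khovanskii.eclSubfield (Set.range t) := ⟨y, hyt⟩
  have hb : Subtype.val ∘ b₀ = b := funext fun i => rfl
  have hφb : ⇑φ ∘ b₀ = b' := funext fun i => by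
    have := hφt (Fin.castSucc i)
    simp only [ht, ht', Fin.snoc_castSucc] at this
    exact this
  have hφy : φ y₀ = y' := by
    have := hφt (Fin.last n)
    simp only [ht, ht', Fin.snoc_last] at this
    exact this
  have hK := ecl_range_comp_val b₀
  have hK' := ecl_range_comp_eHom φ hφ b₀
  rw [hb] at hK
  rw [hφb] at hK'
  constructor
  · intro hy
    rw [hK] at hy
    obtain ⟨c, hc, hcy⟩ := hy
    have : c = y₀ := Subtype.ext hcy
    subst this
    rw [hK', ← hφy]
    exact ⟨y₀, hc, rfl⟩
  · intro hy'
    rw [hK', ← hφy] at hy'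
    obtain ⟨c, hc, hcy⟩ := hy'
    have : c = y₀ := hφinj hcy
    subst this
    rw [hK]
    exact ⟨y₀, hc, rfl⟩

end ClosureDeterminedOver

/-! ### Closed embeddings respecting the base points -/

section ClosedEmbOver

variable {R : Type u} [Field R] [ExponentialRing R] [EclBasePoint P R]
  {K : Type u} [Field K] [ExponentialRing K] [EclBasePoint P K]

/-- **The relation symbols of `Language.eclIsoOver P` are invariant under closed embeddings
respecting the base points** (as `relMap_comp_iff_of_closedEmb`, keeping track of the base).
[cite: Kirby2010QMEC, Lemma 1.3] -/
theorem relMap_comp_iff_of_closedEmb_over (φ : ExponentialRingHom R K)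
    (hφ : ecl (Set.range φ) = Set.range φ) (hφb : ∀ p, φ (basePt P R p) = basePt P K p)
    {k : ℕ} (T : PointedEFieldOver P k) (u : Fin k → R) :
    Structure.RelMap (L := Language.eclIsoOver P) T u ↔
      Structure.RelMap (L := Language.eclIsoOver P) T (⇑φ ∘ u) := by
  have hφinj : Function.Injective φ := φ.toRingHom.injective
  rw [Language.eclIsoOver.relMap_iff, Language.eclIsoOver.relMap_iff]
  constructor
  · rintro ⟨ψ, hψ, hψt, hψb⟩
    refine ⟨φ.comp ψ, ?_, ?_, fun p => ?_⟩
    · change Set.range (⇑φ ∘ ⇑ψ) = _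
      rw [Set.range_comp, hψ, image_ecl_of_closedEmb φ hφ, ← Set.range_comp]
    · change (⇑φ ∘ ⇑ψ) ∘ T.pt = _
      rw [Function.comp_assoc, hψt]
    · change φ (ψ (T.base p)) = _
      rw [hψb, hφb]
  · rintro ⟨ψ', hψ', hψ't, hψ'b⟩
    have hsub : Set.range ψ' ⊆ Set.range φ := by
      rw [hψ', Set.range_comp, ← image_ecl_of_closedEmb φ hφ]
      exact Set.image_subset_range _ _
    obtain ⟨ψ, hψ⟩ := exists_lift_of_closedEmb φ hφ ψ' hsub
    refine ⟨ψ, ?_, ?_, fun p => ?_⟩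
    · apply (Set.image_injective.2 hφinj)
      rw [image_ecl_of_closedEmb φ hφ, ← Set.range_comp, ← Set.range_comp,
        show (⇑φ ∘ ⇑ψ) = ⇑ψ' from funext hψ, hψ']
    · funext i
      apply hφinj
      rw [Function.comp_apply, hψ]
      exact congr_fun hψ't i
    · apply hφinj
      rw [hψ, hψ'b, hφb]

variable {R' : Type u} [Field R'] [ExponentialRing R'] [EclBasePoint P R']
  {K' : Type u} [Field K'] [ExponentialRing K'] [EclBasePoint P K']

/-- Atomic `Language.eclIsoOver P`-formulas are evaluated on a tuple as on its image under a
closed embedding respecting the base points. [folklore] -/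
theorem realize_iff_comp_of_closedEmb_over (φ : ExponentialRingHom R K)
    (hφ : ecl (Set.range φ) = Set.range φ) (hφb : ∀ p, φ (basePt P R p) = basePt P K p)
    {α : Type*} {ψf : (Language.eclIsoOver P).Formula α} (hψf : ψf.IsAtomic) (v : α → R) :
    ψf.Realize v ↔ ψf.Realize (⇑φ ∘ v) := by
  have hφinj : Function.Injective φ := φ.toRingHom.injective
  have hv : Sum.elim (⇑φ ∘ v) (default : Fin 0 → K) = ⇑φ ∘ Sum.elim v (default : Fin 0 → R) := by
    funext s; rcases s with i | j
    · rfl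
    · exact j.elim0
  change BoundedFormula.Realize ψf v default ↔ BoundedFormula.Realize ψf (⇑φ ∘ v) default
  cases hψf with
  | equal t₁ t₂ =>
    simp only [BoundedFormula.realize_bdEqual]
    rw [hv, ← realize_term_eHom_over, ← realize_term_eHom_over, hφinj.eq_iff]
  | rel T ts =>
    simp only [BoundedFormula.realize_rel]
    rw [hv]
    have e2 : (fun i => (ts i).realize (⇑φ ∘ Sum.elim v default)) =
        ⇑φ ∘ fun i => (ts i).realize (Sum.elim v default) := by
      funext i
      simp only [Function.comp_apply, ← realize_term_eHom_over]
    rw [e2]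
    exact relMap_comp_iff_of_closedEmb_over φ hφ hφb T _

/-- **Quantifier-free `Language.eclIsoOver P`-types are invariant under closed embeddings
respecting the base points.** [cite: Kirby2010QMEC, Lemma 1.3] -/
theorem eqQFType₂_comp_iff_of_closedEmb_over (φ : ExponentialRingHom R K)
    (hφ : ecl (Set.range φ) = Set.range φ) (hφb : ∀ p, φ (basePt P R p) = basePt P K p)
    (φ' : ExponentialRingHom R' K') (hφ' : ecl (Set.range φ') = Set.range φ')
    (hφ'b : ∀ p, φ' (basePt P R' p) = basePt P K' p) {α : Type*} (x : α → R) (x' : α → R') :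
    (Language.eclIsoOver P).EqQFType₂ (⇑φ ∘ x) (⇑φ' ∘ x') ↔
      (Language.eclIsoOver P).EqQFType₂ x x' := by
  constructor
  · intro h ψf hψf
    rw [realize_iff_comp_of_closedEmb_over φ hφ hφb hψf,
      realize_iff_comp_of_closedEmb_over φ' hφ' hφ'b hψf]
    exact h ψf hψf
  · intro h ψf hψf
    rw [← realize_iff_comp_of_closedEmb_over φ hφ hφb hψf,
      ← realize_iff_comp_of_closedEmb_over φ' hφ' hφ'b hψf]
    exact h ψf hψf

end ClosedEmbOver

/-! ### Isomorphisms of pointed closures over the base points: two constructions -/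

section EclIsoOverAPI

variable {K : Type u} [Field K] [ExponentialRing K] {K' : Type u} [Field K'] [ExponentialRing K']
  {ι : ExponentialRingHom P K} {ι' : ExponentialRingHom P K'}

/-- **Restriction/extension of an isomorphism of pointed closures** to a tuple `v` with the same
closure as `u`: `v ↦ ψ v` is again one, compatibly with `u ↦ u'` and with the base points.
[cite: Kirby2010QMEC, Lemma 1.3] -/
theorem EclIsoOver.extend {k : ℕ} {u : Fin k → K} {u' : Fin k → K'} (h : EclIsoOver ι ι' u u')
    {m : ℕ} (v : Fin m → K) (hv : ∀ j, v j ∈ ecl (Set.range u))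
    (huv : ∀ i, u i ∈ ecl (Set.range v)) :
    ∃ v' : Fin m → K', EclIsoOver ι ι' v v' ∧ (∀ i j, v j = u i → v' j = u' i) ∧
      (∀ (j) (p : P), v j = ι p → v' j = ι' p) ∧ ∀ j, v' j ∈ ecl (Set.range u') := by
  classical
  obtain ⟨ψ, hψ, hψu, hψb⟩ := h
  have hsub : ecl (Set.range v) ⊆ ecl (Set.range u) :=
    ecl_subset_ecl_of_subset (by rintro _ ⟨j, rfl⟩; exact hv j)
  have hsup : ecl (Set.range u) ⊆ ecl (Set.range v) :=
    ecl_subset_ecl_of_subset (by rintro _ ⟨i, rfl⟩; exact huv i)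
  let v' : Fin m → K' := fun j => ψ ⟨v j, hv j⟩
  have hψcl : ecl (Set.range ψ) = Set.range ψ := by rw [hψ, Khovanskii.ecl_ecl]
  -- `ecl (range v') = ecl (range u') = range ψ`
  have hv'sub : Set.range v' ⊆ ecl (Set.range u') := by
    rintro _ ⟨j, rfl⟩; rw [← hψ]; exact ⟨_, rfl⟩
  have hu'v' : ∀ i, u' i ∈ ecl (Set.range v') := by
    intro i
    have h1 : (⟨u i, subset_ecl _ (Set.mem_range_self i)⟩ : Khovanskii.eclSubfield (Set.range u)) ∈
        ecl (Set.range fun j => (⟨v j, hv j⟩ : Khovanskii.eclSubfield (Set.range u))) := by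
      rw [ZilberTransfer.mem_ecl_range_mk_iff]; exact huv i
    have h2 := Set.mem_image_of_mem ψ h1
    rw [image_ecl_of_closedEmb ψ hψcl, ← Set.range_comp, hψu i] at h2
    exact h2
  have hecl : ecl (Set.range v') = ecl (Set.range u') :=
    Set.Subset.antisymm (ecl_subset_ecl_of_subset hv'sub)
      (ecl_subset_ecl_of_subset (by rintro _ ⟨i, rfl⟩; exact hu'v' i))
  refine ⟨v', ⟨ψ.comp (Khovanskii.eclSubfield.inclusionE hsub), ?_, fun j => ?_, fun p hp => ?_⟩,
    fun i j hij => ?_, fun j p hjp => ?_, fun j => hv'sub ⟨j, rfl⟩⟩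
  · -- range
    rw [hecl, ← hψ]
    ext w
    constructor
    · rintro ⟨z, rfl⟩; exact ⟨_, rfl⟩
    · rintro ⟨z, rfl⟩
      refine ⟨⟨z, hsup z.2⟩, ?_⟩
      change ψ (Khovanskii.eclSubfield.inclusionE hsub ⟨z, hsup z.2⟩) = ψ z
      exact congrArg ψ (Subtype.ext (Khovanskii.eclSubfield.coe_inclusionE_apply hsub _))
  · change ψ (Khovanskii.eclSubfield.inclusionE hsub _) = ψ ⟨v j, hv j⟩
    exact congrArg ψ (Subtype.ext (Khovanskii.eclSubfield.coe_inclusionE_apply hsub _))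
  · change ψ (Khovanskii.eclSubfield.inclusionE hsub _) = ι' p
    rw [← hψb p (hsub hp)]
    exact congrArg ψ (Subtype.ext (Khovanskii.eclSubfield.coe_inclusionE_apply hsub _))
  · change ψ ⟨v j, hv j⟩ = u' i
    rw [← hψu i]
    exact congrArg ψ (Subtype.ext hij)
  · change ψ ⟨v j, hv j⟩ = ι' p
    have hp : ι p ∈ ecl (Set.range u) := hjp ▸ hv j
    rw [← hψb p hp]
    exact congrArg ψ (Subtype.ext hjp)

/-- **The empty tuples are isomorphic over base points onto the prime models**: if
`ι(P) = ecl^K(∅)` and `ι'(P) = ecl^{K'}(∅)` then `ι' ∘ ι⁻¹ : ecl^K(∅) ≅ ecl^{K'}(∅)` over the base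
points. [cite: Kirby2013FPEF, Cor. 6.10] -/
theorem eclIsoOver_elim0 (hι : Set.range ι = ecl (∅ : Set K)) (hι' : Set.range ι' = ecl (∅ : Set K')) :
    EclIsoOver ι ι' (Fin.elim0 : Fin 0 → K) (Fin.elim0 : Fin 0 → K') := by
  classical
  have hcl : ecl (Set.range ι) = Set.range ι := by rw [hι, Khovanskii.ecl_ecl]
  let e := equivRangeOfClosedEmb ι hcl
  have e0 : Set.range (Fin.elim0 : Fin 0 → K) = ∅ := Set.range_eq_empty _
  have e0' : Set.range (Fin.elim0 : Fin 0 → K') = ∅ := Set.range_eq_empty _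
  have h0 : ecl (Set.range (Fin.elim0 : Fin 0 → K)) ⊆ ecl (Set.range ι) := by
    rw [e0, hcl, hι]
  have h0' : ecl (Set.range ι) ⊆ ecl (Set.range (Fin.elim0 : Fin 0 → K)) := by
    rw [e0, hcl, hι]
  let ψ : ExponentialRingHom (Khovanskii.eclSubfield (Set.range (Fin.elim0 : Fin 0 → K))) K' :=
    ι'.comp (e.symm.toExponentialRingHom.comp (Khovanskii.eclSubfield.inclusionE h0))
  have hψ : ∀ z, ψ z = ι' (e.symm (Khovanskii.eclSubfield.inclusionE h0 z)) := fun z => rfl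
  have he : ∀ p (h : ι p ∈ ecl (Set.range ι)), e.symm ⟨ι p, h⟩ = p := fun p h => by
    have : (⟨ι p, h⟩ : Khovanskii.eclSubfield (Set.range ι)) = e p :=
      Subtype.ext (coe_equivRangeOfClosedEmb_apply ι hcl p).symm
    rw [this, ExponentialRingEquiv.symm_apply_apply]
  refine ⟨ψ, ?_, fun i => i.elim0, fun p h => ?_⟩
  · rw [e0', ← hι']
    ext w
    constructor
    · rintro ⟨z, rfl⟩; rw [hψ]; exact ⟨_, rfl⟩
    · rintro ⟨p, rfl⟩
      have hp : ι p ∈ ecl (Set.range (Fin.elim0 : Fin 0 → K)) := h0' (subset_ecl _ ⟨p, rfl⟩)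
      refine ⟨⟨ι p, hp⟩, ?_⟩
      rw [hψ]
      have : Khovanskii.eclSubfield.inclusionE h0 ⟨ι p, hp⟩ = ⟨ι p, h0 hp⟩ :=
        Subtype.ext (Khovanskii.eclSubfield.coe_inclusionE_apply h0 _)
      rw [this, he]
  · rw [hψ]
    have : Khovanskii.eclSubfield.inclusionE h0 ⟨ι p, h⟩ = ⟨ι p, h0 h⟩ :=
      Subtype.ext (Khovanskii.eclSubfield.coe_inclusionE_apply h0 _)
    rw [this, he]

end EclIsoOverAPI

/-! ### The class: closed E-subfields of uncountable Zilber fields, with base points -/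

variable (P) in
/-- **The class of closed E-subfields of uncountable Zilber fields, over the base `P`** (Bays–Kirby
2018, Def. 6.3 and §8; Kirby 2010, axiom I.2; Bays–Kirby 2013, §2.4): a
`Language.eclIsoOver P`-structure-with-closure `⟨H, cl⟩` (with `H : Type u`, the universe of `P`) is a member iff it is
the canonical structure of an exponential field `H` of characteristic zero with a base point
`ι_H : P → H` whose image is `ecl^H(∅)`, with `cl = ecl`, admitting an embedding of exponential
rings into some uncountable Zilber field (in `Type u`) with `ecl`-closed image.
[cite: BaysKirby2018ANT, Def. 6.3 and §8] [cite: Kirby2010QMEC, Def. 1.1 (axiom I.2)] -/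
def ZilberClosedClassOver : ∀ (H : Type u) [(Language.eclIsoOver P).Structure H], (Set H → Set H) → Prop :=
  fun H inst cl => ∃ (iF : Field H) (_ : CharZero H) (iE : ExponentialRing H)
    (iB : @EclBasePoint P _ _ H iF iE),
    @Language.eclIsoOver.instStructure P _ _ H iF iE iB = inst ∧ cl = @ecl H iF iE ∧
    Set.range (@basePt P _ _ H iF iE iB) = @ecl H iF iE ∅ ∧
    ∃ (K : Type u) (iFK : Field K) (_ : CharZero K) (iEK : ExponentialRing K) (_ : IsZilberField K)
      (_ : ℵ₀ < #K) (φ : @ExponentialRingHom H K _ _ iE iEK),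
        @ecl K iFK iEK (Set.range φ) = Set.range φ

/-- An uncountable Zilber field (in `Type u`) with a base point onto `ecl(∅)`, with its canonical
structure and `ecl`, is a member. [folklore] -/
theorem zilberClosedClassOver_of_isZilberField {K : Type u} [Field K] [CharZero K] [ExponentialRing K]
    [EclBasePoint P K] (hK : IsZilberField K) (hKu : ℵ₀ < #K)
    (hι : Set.range (basePt P K) = ecl (∅ : Set K)) : ZilberClosedClassOver P K ecl :=
  ⟨_, ‹_›, _, ‹_›, rfl, rfl, hι, K, _, ‹_›, _, hK, hKu, ExponentialRingHom.id K, ecl_range_id⟩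

namespace ZilberClosedClassOver

/-! ### The elementary axioms (3i), (3iii) -/

section Elementary

variable {H H' : Type u} [(Language.eclIsoOver P).Structure H] [(Language.eclIsoOver P).Structure H']
  {cl : Set H → Set H} {cl' : Set H' → Set H'}

/-- Axiom (3i), pregeometry. [cite: Kirby2010EAEF, Thm 1.1] -/
theorem isPregeometry (hH : ZilberClosedClassOver P H cl) : IsPregeometry cl := by
  obtain ⟨iF, _, iE, iB, -, rfl, -⟩ := hH
  exact isPregeometry_ecl H

/-- Axiom (3i), countable closure (along the closed embedding into the Zilber field).
[cite: BaysKirby2018ANT, Thm 9.1 (axiom 5)] -/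
theorem countable_cl (hH : ZilberClosedClassOver P H cl) (A : Set H) (hA : A.Finite) :
    (cl A).Countable := by
  obtain ⟨iF, _, iE, iB, -, rfl, -, K, iFK, _, iEK, hK, -, φ, hφ⟩ := hH
  have h1 : (φ '' ecl A).Countable := by
    rw [image_ecl_of_closedEmb φ hφ]
    exact hK.hasCountableClosureProperty _ (hA.image _).countable
  exact Set.countable_of_injective_of_countable_image φ.toRingHom.injective.injOn h1

/-- In a member in `Type`, equal quantifier-free `Language.eclIsoOver P₀`-types give equal
quantifier-free `Language.eclIso`-types (forget the base; the closure-isomorphism language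
`Language.eclIso` is indexed by pointed E-fields in `Type`). [folklore] -/
theorem eqQFType₂_eclIso_of {P₀ : Type} [Field P₀] [ExponentialRing P₀]
    {H H' : Type} [Field H] [ExponentialRing H] [EclBasePoint P₀ H]
    [Field H'] [ExponentialRing H'] [EclBasePoint P₀ H']
    (hι : Set.range (basePt P₀ H) = ecl (∅ : Set H)) {n : ℕ} {x : Fin n → H} {x' : Fin n → H'}
    (h : (Language.eclIsoOver P₀).EqQFType₂ x x') : Language.eclIso.EqQFType₂ x x' :=
  (eclIsoOver_of_eqQFType₂ (fun p => hι ▸ ⟨p, rfl⟩) h).eqQFType₂_eclIso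

/-- Axiom (3iii): the closure is determined by partial embeddings
(`mem_ecl_range_iff_of_eqQFType₂_snoc_over`).
[cite: Kirby2010QMEC, Def. 1.1 (axiom I.3) and Lemma 1.3] -/
theorem mem_cl_iff_of_isPartialEmbOn (hH : ZilberClosedClassOver P H cl)
    (hH' : ZilberClosedClassOver P H' cl') (X : Set H) (y : H) (f : H → H')
    (hf : IsPartialEmbOn (Language.eclIsoOver P) f (insert y X)) :
    y ∈ cl X ↔ f y ∈ cl' (f '' X) := by
  obtain ⟨iF, _, iE, iB, rfl, rfl, hι, -⟩ := hH
  obtain ⟨iF', _, iE', iB', rfl, rfl, -, -⟩ := hH'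
  have hP := isPregeometry_ecl H
  have hP' := isPregeometry_ecl H'
  have key : ∀ {n : ℕ} (b : Fin n → H), Set.range b ⊆ X →
      (y ∈ ecl (Set.range b) ↔ f y ∈ ecl (Set.range (f ∘ b))) := by
    intro n b hb
    have hιp : ∀ p, basePt P H p ∈ ecl (∅ : Set H) := fun p => hι ▸ ⟨p, rfl⟩
    refine mem_ecl_range_iff_of_eqQFType₂_snoc_over hιp ?_
    have hmem : ∀ i, (Fin.snoc b y : Fin (n + 1) → H) i ∈ insert y X := fun i => by
      refine Fin.lastCases ?_ (fun j => ?_) i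
      · simp
      · simpa using Or.inr (hb ⟨j, rfl⟩)
    have := hf _ hmem
    have e : f ∘ (Fin.snoc b y : Fin (n + 1) → H) = Fin.snoc (f ∘ b) (f y) := by
      funext i
      refine Fin.lastCases ?_ (fun j => ?_) i <;> simp
    rwa [e] at this
  constructor
  · intro hy
    obtain ⟨X₀, hX₀X, hX₀fin, hyX₀⟩ := hP.finite_character hy
    obtain ⟨n, b, hb⟩ := hX₀fin.fin_embedding
    have hy' : y ∈ ecl (Set.range b) := by rw [hb]; exact hyX₀
    have := (key b (hb ▸ hX₀X)).1 hy'
    refine hP'.mono ?_ this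
    rw [Set.range_comp]
    exact Set.image_mono (hb ▸ hX₀X)
  · intro hy
    obtain ⟨Y₀, hY₀, hY₀fin, hyY₀⟩ := hP'.finite_character hy
    have : ∀ z : Y₀, ∃ x ∈ X, f x = z := fun z => hY₀ z.2
    choose g hgX hgf using this
    haveI : Finite Y₀ := hY₀fin.to_subtype
    obtain ⟨n, ⟨e⟩⟩ := Finite.exists_equiv_fin Y₀
    let b : Fin n → H := fun i => g (e.symm i)
    have hbX : Set.range b ⊆ X := by rintro _ ⟨i, rfl⟩; exact hgX _
    have hfb : Set.range (f ∘ b) = Y₀ := by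
      ext z
      simp only [Set.mem_range, Function.comp_apply, b]
      constructor
      · rintro ⟨i, rfl⟩; rw [hgf]; exact (e.symm i).2
      · intro hz; exact ⟨e ⟨z, hz⟩, by rw [e.symm_apply_apply, hgf]⟩
    have hy' : f y ∈ ecl (Set.range (f ∘ b)) := by rw [hfb]; exact hyY₀
    have := (key b hbX).2 hy'
    exact hP.mono hbX this

end Elementary

end ZilberClosedClassOver

/-! ### Axiom (1): closure under isomorphisms -/

section Transport

variable {K : Type u} [Field K] [CharZero K] [ExponentialRing K] [EclBasePoint P K]
  {K₀ : Type u} [Field K₀] [CharZero K₀] [ExponentialRing K₀]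
  {H' : Type u} [(Language.eclIsoOver P).Structure H']

/-- **Transport of a member along an isomorphism of `Language.eclIsoOver P`-structures** (the
field, exponential, base point and closed embedding are transported; the given structure on `H'` is
the canonical one). [cite: Haykazyan2016, Definition 2] -/
theorem zilberClosedClassOver_of_equiv_of_closedEmb (hK₀ : IsZilberField K₀) (hK₀u : ℵ₀ < #K₀)
    (hι : Set.range (basePt P K) = ecl (∅ : Set K))
    (φ : ExponentialRingHom K K₀) (hφ : ecl (Set.range φ) = Set.range φ)
    (e : K ≃[Language.eclIsoOver P] H') :
    ZilberClosedClassOver P H' (fun X' => e '' ecl (e ⁻¹' X')) := by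
  classical
  let E : H' ≃ K := e.toEquiv.symm
  letI iF' : Field H' := E.field
  let r : H' ≃+* K := E.ringEquiv
  have hr : ∀ y, r y = E y := fun y => rfl
  have hrs : ∀ x, r.symm x = e x := fun x => rfl
  haveI iCZ' : CharZero H' := RingHom.charZero r.toRingHom
  letI iE' : ExponentialRing H' :=
    { exp := fun y => r.symm (ExponentialRing.exp (r y))
      exp_zero := by
        change r.symm (ExponentialRing.exp (r 0)) = 1
        rw [map_zero, ExponentialRing.exp_zero, map_one]
      exp_add := fun x y => by
        change r.symm (ExponentialRing.exp (r (x + y))) =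
          r.symm (ExponentialRing.exp (r x)) * r.symm (ExponentialRing.exp (r y))
        rw [map_add, ExponentialRing.exp_add, map_mul] }
  have hexp' : ∀ y : H', ExponentialRing.exp y = r.symm (ExponentialRing.exp (r y)) := fun y => rfl
  -- the isomorphism of exponential fields `K ≃ H'`
  let eE : ExponentialRingEquiv K H' :=
    { r.symm with
      map_exp' := fun x => by
        change r.symm (ExponentialRing.exp x) = ExponentialRing.exp (r.symm x)
        rw [hexp', RingEquiv.apply_symm_apply] }
  have heE : ∀ x, eE x = e x := fun x => rfl
  have heEfun : (⇑eE : K → H') = ⇑e := funext heE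
  have hEe : ∀ y, e (E y) = y := fun y => e.toEquiv.apply_symm_apply y
  -- the transported base point
  letI iB' : EclBasePoint P H' := ⟨eE.toExponentialRingHom.comp (basePt P K)⟩
  have hB' : ∀ p, basePt P H' p = eE (basePt P K p) := fun p => rfl
  -- the new closed embedding `φ ∘ eE⁻¹ : H' → K₀`
  let φ' : ExponentialRingHom H' K₀ := φ.comp eE.symm.toExponentialRingHom
  have hrange : Set.range φ' = Set.range φ := by
    ext z
    constructor
    · rintro ⟨y, rfl⟩; exact ⟨eE.symm y, rfl⟩
    · rintro ⟨x, rfl⟩; exact ⟨eE x, by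
        change φ (eE.symm (eE x)) = φ x
        rw [ExponentialRingEquiv.symm_apply_apply]⟩
  have hφ' : ecl (Set.range φ') = Set.range φ' := by rw [hrange, hφ]
  refine ⟨iF', iCZ', iE', iB', ?_, ?_, ?_, K₀, _, ‹_›, _, hK₀, hK₀u, φ', hφ'⟩
  · -- the given structure is the canonical one of the transported exponential field
    refine structure_ext (fun f v => ?_) (fun R v => ?_)
    · have hv : ⇑e ∘ (⇑E ∘ v) = v := funext fun i => hEe (v i)
      have key := e.map_fun f (⇑E ∘ v)
      rw [hv] at key
      rw [← key]
      cases f with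
      | add => rfl
      | mul => rfl
      | neg => rfl
      | zero => rfl
      | one => rfl
      | exp => rfl
    · have hv : ⇑e ∘ (⇑E ∘ v) = v := funext fun i => hEe (v i)
      have key := e.map_rel R (⇑E ∘ v)
      rw [hv] at key
      rw [key, Language.eclIsoOver.relMap_iff, Language.eclIsoOver.relMap_iff]
      constructor
      · rintro ⟨φ₁, hφ₁, hφ₁t, hφ₁b⟩
        refine ⟨eE.symm.toExponentialRingHom.comp φ₁, ?_, ?_, fun p => ?_⟩
        · have hsymm : ⇑eE.symm ∘ v = ⇑E ∘ v := funext fun i => by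
            apply eE.injective
            change eE (eE.symm (v i)) = eE (E (v i))
            rw [ExponentialRingEquiv.apply_symm_apply, heE, hEe]
          change Set.range (⇑eE.symm ∘ ⇑φ₁) = _
          rw [Set.range_comp, hφ₁, Khovanskii.image_ecl_equiv, ← Set.range_comp, hsymm]
        · funext i
          have hi := congr_fun hφ₁t i
          apply eE.injective
          change eE (eE.symm (φ₁ (R.pt i))) = eE (E (v i))
          rw [ExponentialRingEquiv.apply_symm_apply, heE, hEe]
          exact hi
        · change eE.symm (φ₁ (R.base p)) = basePt P K p
          rw [hφ₁b p, hB', ExponentialRingEquiv.symm_apply_apply]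
      · rintro ⟨φ₁, hφ₁, hφ₁t, hφ₁b⟩
        refine ⟨eE.toExponentialRingHom.comp φ₁, ?_, ?_, fun p => ?_⟩
        · change Set.range (⇑eE ∘ ⇑φ₁) = _
          rw [Set.range_comp, hφ₁, Khovanskii.image_ecl_equiv, ← Set.range_comp, heEfun, hv]
        · funext i
          have hi := congr_fun hφ₁t i
          change eE (φ₁ (R.pt i)) = v i
          rw [show φ₁ (R.pt i) = E (v i) from hi, heE, hEe]
        · change eE (φ₁ (R.base p)) = basePt P H' p
          rw [hφ₁b p, hB']
  · -- the transported closure is `ecl`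
    funext X'
    rw [← heEfun, Khovanskii.image_ecl_equiv, heEfun, Set.image_preimage_eq X' e.surjective]
  · -- the transported base point is onto `ecl ∅`
    change Set.range (⇑eE ∘ ⇑(basePt P K)) = ecl ∅
    rw [Set.range_comp, hι, Khovanskii.image_ecl_equiv, Set.image_empty]

variable {H : Type u} [(Language.eclIsoOver P).Structure H] {cl : Set H → Set H}

/-- **Axiom (1) for `ZilberClosedClassOver P`.** [cite: Haykazyan2016, Definition 2] -/
theorem ZilberClosedClassOver.of_equiv (hH : ZilberClosedClassOver P H cl)
    (e : H ≃[Language.eclIsoOver P] H') :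
    ZilberClosedClassOver P H' (fun X' => e '' cl (e ⁻¹' X')) := by
  obtain ⟨iF, iCZ, iE, iB, rfl, rfl, hι, K₀, iFK, iCK, iEK, hK₀, hK₀u, φ, hφ⟩ := hH
  exact zilberClosedClassOver_of_equiv_of_closedEmb hK₀ hK₀u hι φ hφ e

end Transport

/-! ### Axiom (3ii): closed subsets are members -/

section ClosedSubsets

variable {K : Type u} [Field K] [ExponentialRing K] [EclBasePoint P K]

/-- The `ecl`-closed E-subfield `ecl X ≤ K` as a `Language.eclIsoOver P`-substructure.
[cite: Kirby2010EAEF, Lemma 3.3] -/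
def _root_.Literature.NumberTheory.Transcendental.Language.eclIsoOver.eclSubstructure (X : Set K) :
    (Language.eclIsoOver P).Substructure K where
  carrier := ecl X
  fun_mem := by
    intro n f v hv
    cases f with
    | add => exact Khovanskii.add_mem_ecl (hv 0) (hv 1)
    | mul => exact Khovanskii.mul_mem_ecl (hv 0) (hv 1)
    | neg => exact Khovanskii.neg_mem_ecl (hv 0)
    | zero => exact Khovanskii.zero_mem_ecl X
    | one => exact Khovanskii.one_mem_ecl X
    | exp => exact Khovanskii.exp_mem_ecl (hv 0)

/-- The carrier of `eclSubstructure X` is `ecl X`. [folklore] -/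
@[simp] theorem _root_.Literature.NumberTheory.Transcendental.Language.eclIsoOver.coe_eclSubstructure
    (X : Set K) :
    ((Language.eclIsoOver.eclSubstructure X : (Language.eclIsoOver P).Substructure K) : Set K) =
      ecl X := rfl

variable [CharZero K] {K₀ : Type u} [Field K₀] [CharZero K₀] [ExponentialRing K₀]

/-- **Closed subsets of members are members** (Kirby 2010, axiom I.2; Bays–Kirby 2018, Def. 6.3):
the substructure `ecl X` of `K`, with the base point co-restricted to it, the restricted closure,
and the closed embedding `φ ∘ (ecl X ↪ K)`. [cite: Kirby2010QMEC, Def. 1.1 (axiom I.2)]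
[cite: BaysKirby2018ANT, Def. 6.3] -/
theorem zilberClosedClassOver_eclSubstructure (hK₀ : IsZilberField K₀) (hK₀u : ℵ₀ < #K₀)
    (hι : Set.range (basePt P K) = ecl (∅ : Set K))
    (φ : ExponentialRingHom K K₀) (hφ : ecl (Set.range φ) = Set.range φ) (X : Set K) :
    ZilberClosedClassOver P (Language.eclIsoOver.eclSubstructure (P := P) X)
      (restrictCl ecl (ecl X)) := by
  let F := Khovanskii.eclSubfield X
  have hιX : ∀ p, basePt P K p ∈ ecl X := fun p =>
    ecl_mono (Set.empty_subset _) (hι ▸ ⟨p, rfl⟩)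
  letI iBF : EclBasePoint P F := ⟨ExponentialRingHom.codRestrictEcl (basePt P K) X hιX⟩
  have hrel : ∀ {k : ℕ} (R : PointedEFieldOver P k) (v : Fin k → F),
      Structure.RelMap (L := Language.eclIsoOver P) R v ↔
        Structure.RelMap (L := Language.eclIsoOver P) R (Subtype.val ∘ v) := fun R v =>
    relMap_comp_iff_of_closedEmb_over (Khovanskii.eclSubfield.eHom X) (ecl_range_eHom X)
      (fun _ => rfl) R v
  have hcl : ∀ Y : Set F, (Subtype.val ⁻¹' ecl (Subtype.val '' Y) : Set F) = ecl Y := fun Y => by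
    ext z
    rw [Set.mem_preimage, ← Khovanskii.eclSubfield.image_ecl]
    exact ⟨fun ⟨c, hc, hcz⟩ => by rwa [← Subtype.ext hcz], fun hz => ⟨z, hz, rfl⟩⟩
  letI iFS : Field (Language.eclIsoOver.eclSubstructure (P := P) X) := (inferInstance : Field F)
  haveI iCS : CharZero (Language.eclIsoOver.eclSubstructure (P := P) X) :=
    (inferInstance : CharZero F)
  letI iES : ExponentialRing (Language.eclIsoOver.eclSubstructure (P := P) X) :=
    (inferInstance : ExponentialRing F)
  letI iBS : EclBasePoint P (Language.eclIsoOver.eclSubstructure (P := P) X) := iBF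
  let ψ : ExponentialRingHom (Language.eclIsoOver.eclSubstructure (P := P) X) K :=
    Khovanskii.eclSubfield.eHom X
  have hψ : ecl (Set.range ψ) = Set.range ψ := ecl_range_eHom X
  refine ⟨iFS, iCS, iES, iBS, ?_, ?_, ?_, K₀, _, ‹_›, _, hK₀, hK₀u, φ.comp ψ,
    ecl_range_comp_of_closedEmb ψ hψ φ hφ⟩
  · refine structure_ext (fun f v => ?_) (fun R v => ?_)
    · cases f <;> rfl
    · exact hrel R v
  · funext Y
    exact hcl Y
  · -- the co-restricted base point is onto `ecl ∅` of `ecl X`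
    have key : Set.range (basePt P F) = ecl (∅ : Set F) := by
      ext z
      rw [ZilberTransfer.mem_ecl_empty_sub_iff, ← hι]
      constructor
      · rintro ⟨p, rfl⟩; exact ⟨p, rfl⟩
      · rintro ⟨p, hp⟩; exact ⟨p, Subtype.ext hp⟩
    exact key

variable {H : Type u} [(Language.eclIsoOver P).Structure H] {cl : Set H → Set H}

/-- **Axiom (3ii) for `ZilberClosedClassOver P`.** [cite: Kirby2010QMEC, Def. 1.1 (axiom I.2)] -/
theorem ZilberClosedClassOver.cl_mem (hH : ZilberClosedClassOver P H cl) (X : Set H) :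
    ∃ S : (Language.eclIsoOver P).Substructure H, (S : Set H) = cl X ∧
      ZilberClosedClassOver P S (restrictCl cl (S : Set H)) := by
  obtain ⟨iF, iCZ, iE, iB, rfl, rfl, hι, K₀, iFK, iCK, iEK, hK₀, hK₀u, φ, hφ⟩ := hH
  exact ⟨Language.eclIsoOver.eclSubstructure X, rfl,
    zilberClosedClassOver_eclSubstructure hK₀ hK₀u hι φ hφ X⟩

end ClosedSubsets

/-! ### Axioms (2), (4): the ambient uncountable Zilber fields -/

section Transfer

variable {H K H' K' : Type u} [Field H] [ExponentialRing H] [EclBasePoint P H]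
  [Field K] [ExponentialRing K] [EclBasePoint P K]
  [Field H'] [ExponentialRing H'] [EclBasePoint P H'] [Field K'] [ExponentialRing K']
  [EclBasePoint P K']

/-- **Pushing a partial map between members forward to the ambient Zilber fields** (as
`exists_pushforward`, for `Language.eclIsoOver P` and closed embeddings respecting the base
points). [folklore] -/
theorem exists_pushforward_over (φ : ExponentialRingHom H K) (hφ : ecl (Set.range φ) = Set.range φ)
    (hφb : ∀ p, φ (basePt P H p) = basePt P K p)
    (φ' : ExponentialRingHom H' K') (hφ' : ecl (Set.range φ') = Set.range φ')
    (hφ'b : ∀ p, φ' (basePt P H' p) = basePt P K' p)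
    {G : Set H} (hG : ecl G = G) {g : H → H'} (hg : IsPartialEmbOn (Language.eclIsoOver P) g G) :
    ∃ gK : K → K', (∀ h, gK (φ h) = φ' (g h)) ∧ ecl (φ '' G) = φ '' G ∧
      gK '' (φ '' G) = φ' '' (g '' G) ∧ IsPartialEmbOn (Language.eclIsoOver P) gK (φ '' G) := by
  haveI : Nonempty H := ⟨0⟩
  have hφinj : Function.Injective φ := φ.toRingHom.injective
  let gK : K → K' := fun z => φ' (g (Function.invFun φ z))
  have hgK : ∀ h, gK (φ h) = φ' (g h) := fun h => by
    show φ' (g (Function.invFun φ (φ h))) = φ' (g h)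
    rw [Function.leftInverse_invFun hφinj h]
  have himg : gK '' (φ '' G) = φ' '' (g '' G) := by
    rw [Set.image_image, Set.image_image]
    exact Set.image_congr fun h _ => hgK h
  refine ⟨gK, hgK, by rw [← image_ecl_of_closedEmb φ hφ, hG], himg, ?_⟩
  intro n u hu
  choose u₀ hu₀G hu₀ using hu
  have eu : u = ⇑φ ∘ u₀ := funext fun i => (hu₀ i).symm
  have egu : gK ∘ u = ⇑φ' ∘ (g ∘ u₀) := funext fun i => by
    rw [Function.comp_apply, ← hu₀ i, hgK]; rfl
  rw [egu, eu]
  exact (eqQFType₂_comp_iff_of_closedEmb_over φ hφ hφb φ' hφ' hφ'b u₀ (g ∘ u₀)).2 (hg u₀ hu₀G)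

/-- Pulling an `EqQFTypeOver₂` back from the ambient fields. [folklore] -/
theorem eqQFTypeOver₂_of_pushforward_over (φ : ExponentialRingHom H K)
    (hφ : ecl (Set.range φ) = Set.range φ) (hφb : ∀ p, φ (basePt P H p) = basePt P K p)
    (φ' : ExponentialRingHom H' K') (hφ' : ecl (Set.range φ') = Set.range φ')
    (hφ'b : ∀ p, φ' (basePt P H' p) = basePt P K' p)
    {G : Set H} {g : H → H'} {gK : K → K'} (hgK : ∀ h, gK (φ h) = φ' (g h)) {n : ℕ}
    {t : Fin n → H} {t' : Fin n → H'}
    (h : (Language.eclIsoOver P).EqQFTypeOver₂ (φ '' G) gK (⇑φ ∘ t) (⇑φ' ∘ t')) :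
    (Language.eclIsoOver P).EqQFTypeOver₂ G g t t' := by
  intro m σ hσ
  have key := h (⇑φ ∘ σ) fun i => Set.mem_image_of_mem φ (hσ i)
  rw [show gK ∘ (⇑φ ∘ σ) = ⇑φ' ∘ (g ∘ σ) from funext fun i => hgK (σ i), ← comp_append',
    ← comp_append'] at key
  exact (eqQFType₂_comp_iff_of_closedEmb_over φ hφ hφb φ' hφ' hφ'b _ _).1 key

/-- Pushing an `EqQFTypeOver₂` forward to the ambient fields. [folklore] -/
theorem eqQFTypeOver₂_pushforward_over (φ : ExponentialRingHom H K)
    (hφ : ecl (Set.range φ) = Set.range φ) (hφb : ∀ p, φ (basePt P H p) = basePt P K p)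
    (φ' : ExponentialRingHom H' K') (hφ' : ecl (Set.range φ') = Set.range φ')
    (hφ'b : ∀ p, φ' (basePt P H' p) = basePt P K' p)
    {G : Set H} {g : H → H'} {gK : K → K'} (hgK : ∀ h, gK (φ h) = φ' (g h)) {n : ℕ}
    {t : Fin n → H} {t' : Fin n → H'} (h : (Language.eclIsoOver P).EqQFTypeOver₂ G g t t') :
    (Language.eclIsoOver P).EqQFTypeOver₂ (φ '' G) gK (⇑φ ∘ t) (⇑φ' ∘ t') := by
  intro m σK hσK
  choose σ hσG hσ using hσK
  have eσ : σK = ⇑φ ∘ σ := funext fun i => (hσ i).symm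
  have key := (eqQFType₂_comp_iff_of_closedEmb_over φ hφ hφb φ' hφ' hφ'b _ _).2 (h σ hσG)
  rw [comp_append', comp_append'] at key
  rw [eσ, show gK ∘ (⇑φ ∘ σ) = ⇑φ' ∘ (g ∘ σ) from funext fun i => hgK (σ i)]
  exact key

end Transfer

namespace ZilberClosedClassOver

/-! ### Axioms (2) and (4) -/

section Homogeneity

variable {H H' : Type u} [(Language.eclIsoOver P).Structure H] [(Language.eclIsoOver P).Structure H']
  {cl : Set H → Set H} {cl' : Set H' → Set H'}

/-- **Axiom (2) for `ZilberClosedClassOver P`**: any two members satisfy the same quantifier-free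
sentences — their prime models are isomorphic over the base points (`eclIsoOver_elim0`).
[cite: Kirby2013FPEF, Cor. 6.10] -/
theorem eqQFType₂_elim0 (hH : ZilberClosedClassOver P H cl) (hH' : ZilberClosedClassOver P H' cl') :
    (Language.eclIsoOver P).EqQFType₂ (Fin.elim0 : Fin 0 → H) (Fin.elim0 : Fin 0 → H') := by
  obtain ⟨iF, iCZ, iE, iB, rfl, rfl, hι, -⟩ := hH
  obtain ⟨iF', iCZ', iE', iB', rfl, rfl, hι', -⟩ := hH'
  exact eqQFType₂_of_eclIsoOver (fun p => hι ▸ ⟨p, rfl⟩) (eclIsoOver_elim0 hι hι')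

/-- **Axiom (4ii) over `∅` for `ZilberClosedClassOver P`**: a partial embedding `x ↦ x'` (an
isomorphism of pointed closures over the base points) extends over any point of `ecl(x)` (by the
same isomorphism, `EclIsoOver.extend`). [cite: Haykazyan2016, Definition 2] -/
theorem exists_eqQFType₂_snoc (hH : ZilberClosedClassOver P H cl) (hH' : ZilberClosedClassOver P H' cl')
    ⦃n : ℕ⦄ (x : Fin n → H) (x' : Fin n → H') (hxx' : (Language.eclIsoOver P).EqQFType₂ x x')
    ⦃y : H⦄ (hy : y ∈ cl (Set.range x)) :
    ∃ y' : H', (Language.eclIsoOver P).EqQFType₂ (Fin.snoc x y : Fin (n + 1) → H) (Fin.snoc x' y') := by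
  obtain ⟨iF, iCZ, iE, iB, rfl, rfl, hι, -⟩ := hH
  obtain ⟨iF', iCZ', iE', iB', rfl, rfl, hι', -⟩ := hH'
  have hιp : ∀ p, basePt P H p ∈ ecl (∅ : Set H) := fun p => hι ▸ ⟨p, rfl⟩
  have h := eclIsoOver_of_eqQFType₂ hιp hxx'
  obtain ⟨v', hv', hvu, -, -⟩ := h.extend (Fin.snoc x y : Fin (n + 1) → H)
    (fun j => by
      refine Fin.lastCases ?_ (fun i => ?_) j
      · rw [Fin.snoc_last]; exact hy
      · rw [Fin.snoc_castSucc]; exact subset_ecl _ ⟨i, rfl⟩)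
    (fun i => subset_ecl _ ⟨Fin.castSucc i, by simp⟩)
  refine ⟨v' (Fin.last n), eqQFType₂_of_eclIsoOver hιp ?_⟩
  have e : v' = Fin.snoc x' (v' (Fin.last n)) := by
    funext j
    refine Fin.lastCases ?_ (fun i => ?_) j
    · rw [Fin.snoc_last]
    · rw [Fin.snoc_castSucc]
      exact hvu i (Fin.castSucc i) (by simp)
  rwa [e] at hv'

/-- The induced base point `φ ∘ ι_H` of the ambient field of a member (closed embedding
`φ : H → K₀`) is onto the prime model `ecl^{K₀}(∅)`. [cite: Kirby2010QMEC, Lemma 1.3] -/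
theorem range_comp_basePt_eq {H : Type u} [Field H] [CharZero H] [ExponentialRing H] [EclBasePoint P H]
    (hι : Set.range (basePt P H) = ecl (∅ : Set H))
    {K₀ : Type u} [Field K₀] [CharZero K₀] [ExponentialRing K₀]
    (φ : ExponentialRingHom H K₀) (hφ : ecl (Set.range φ) = Set.range φ) :
    Set.range (φ.comp (basePt P H)) = ecl (∅ : Set K₀) := by
  change Set.range (⇑φ ∘ ⇑(basePt P H)) = ecl ∅
  rw [Set.range_comp, hι, image_ecl_of_closedEmb φ hφ, Set.image_empty]

/-- **Axiom (4i) over countable closed sets for `ZilberClosedClassOver P`**: uniqueness of the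
generic type over a countable closed set across two members — transferred to the ambient
uncountable Zilber fields (`exists_pushforward_over`) where it is
`ZilberTransfer.eclIsoOver_append_of_notMem`. [cite: BaysKirby2013Excellence, Prop. 5 (i)]
[cite: Kirby2010QMEC, Def. 1.1 (axiom II.1)] -/
theorem eqQFTypeOver₂_of_notMem_of_closed (hH : ZilberClosedClassOver P H cl)
    (hH' : ZilberClosedClassOver P H' cl') (G : Set H) (g : H → H') (hGc : G.Countable)
    (hG : cl G = G) (hgG : cl' (g '' G) = g '' G) (hg : IsPartialEmbOn (Language.eclIsoOver P) g G)
    ⦃x : H⦄ ⦃x' : H'⦄ (hx : x ∉ cl G) (hx' : x' ∉ cl' (g '' G)) :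
    (Language.eclIsoOver P).EqQFTypeOver₂ G g ![x] ![x'] := by
  classical
  obtain ⟨iF, iCZ, iE, iB, rfl, rfl, hι, K₀, iFK, iCK, iEK, hK₀, hK₀u, φ, hφ⟩ := hH
  obtain ⟨iF', iCZ', iE', iB', rfl, rfl, hι', K₀', iFK', iCK', iEK', hK₀', hK₀'u, φ', hφ'⟩ := hH'
  letI : EclBasePoint P K₀ := ⟨φ.comp (basePt P H)⟩
  letI : EclBasePoint P K₀' := ⟨φ'.comp (basePt P H')⟩
  have hφb : ∀ p, φ (basePt P H p) = basePt P K₀ p := fun p => rfl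
  have hφ'b : ∀ p, φ' (basePt P H' p) = basePt P K₀' p := fun p => rfl
  have hι₀ : Set.range (basePt P K₀) = ecl (∅ : Set K₀) := range_comp_basePt_eq hι φ hφ
  have hι₀' : Set.range (basePt P K₀') = ecl (∅ : Set K₀') := range_comp_basePt_eq hι' φ' hφ'
  have hι₀p : ∀ p, basePt P K₀ p ∈ ecl (∅ : Set K₀) := fun p => hι₀ ▸ ⟨p, rfl⟩
  have hφinj : Function.Injective φ := φ.toRingHom.injective
  have hφ'inj : Function.Injective φ' := φ'.toRingHom.injective
  obtain ⟨gK, hgK, hGK, himg, hgKemb⟩ := exists_pushforward_over φ hφ hφb φ' hφ' hφ'b hG hg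
  have himgcl : ecl (gK '' (φ '' G)) = gK '' (φ '' G) := by
    rw [himg, ← image_ecl_of_closedEmb φ' hφ', hgG]
  have hxK : φ x ∉ φ '' G := fun h => by
    obtain ⟨z, hz, hzx⟩ := h
    exact hx (hG.symm ▸ hφinj hzx ▸ hz)
  have hxK' : φ' x' ∉ gK '' (φ '' G) := fun h => by
    rw [himg] at h
    obtain ⟨z, hz, hzx⟩ := h
    exact hx' (hgG.symm ▸ hφ'inj hzx ▸ hz)
  have hKu : ¬ (Set.univ : Set K₀).Countable := fun h =>
    (Cardinal.aleph0_lt_mk_iff.1 hK₀u).not_countable (Set.countable_univ_iff.1 h)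
  have hK'u : ¬ (Set.univ : Set K₀').Countable := fun h =>
    (Cardinal.aleph0_lt_mk_iff.1 hK₀'u).not_countable (Set.countable_univ_iff.1 h)
  -- the partial embedding on `φ G`, as isomorphisms of pointed closures over the base points
  have hpe : ∀ ⦃k : ℕ⦄ (a : Fin k → K₀), (∀ i, a i ∈ φ '' G) →
      EclIsoOver (basePt P K₀) (basePt P K₀') a (gK ∘ a) := fun k a ha =>
    eclIsoOver_of_eqQFType₂ hι₀p (hgKemb a ha)
  have key := ZilberTransfer.eclIsoOver_append_of_notMem hK₀ hK₀' hKu hK'u hι₀ hι₀'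
    (hGc.image φ) hGK himgcl hpe hxK hxK'
  have hK : (Language.eclIsoOver P).EqQFTypeOver₂ (φ '' G) gK ![φ x] ![φ' x'] := fun k a ha =>
    eqQFType₂_of_eclIsoOver hι₀p (key a ha)
  rw [← comp_vecSingle, ← comp_vecSingle] at hK
  exact eqQFTypeOver₂_of_pushforward_over φ hφ hφb φ' hφ' hφ'b hgK hK

/-- **Axiom (4ii) over countable closed sets for `ZilberClosedClassOver P`**: `ℵ₀`-homogeneity over
a countable closed set across two members — transferred to the ambient uncountable Zilber fields
where it is `ZilberTransfer.exists_eclIsoOver_append_snoc`; the partner lies in the image of `H'`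
(finite character of `ecl`). [cite: BaysKirby2013Excellence, Prop. 5 (ii)]
[cite: Kirby2010QMEC, Def. 1.1 (axiom II.2)] -/
theorem exists_eqQFTypeOver₂_snoc_of_closed (hH : ZilberClosedClassOver P H cl)
    (hH' : ZilberClosedClassOver P H' cl') (G : Set H) (g : H → H') (hGc : G.Countable)
    (hG : cl G = G) (hgG : cl' (g '' G) = g '' G) ⦃n : ℕ⦄ (x : Fin n → H) (x' : Fin n → H')
    (hxx' : (Language.eclIsoOver P).EqQFTypeOver₂ G g x x') ⦃y : H⦄
    (hy : y ∈ cl (G ∪ Set.range x)) :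
    ∃ y' : H', (Language.eclIsoOver P).EqQFTypeOver₂ G g (Fin.snoc x y : Fin (n + 1) → H)
      (Fin.snoc x' y') := by
  classical
  obtain ⟨iF, iCZ, iE, iB, rfl, rfl, hι, K₀, iFK, iCK, iEK, hK₀, hK₀u, φ, hφ⟩ := hH
  obtain ⟨iF', iCZ', iE', iB', rfl, rfl, hι', K₀', iFK', iCK', iEK', hK₀', hK₀'u, φ', hφ'⟩ := hH'
  letI : EclBasePoint P K₀ := ⟨φ.comp (basePt P H)⟩
  letI : EclBasePoint P K₀' := ⟨φ'.comp (basePt P H')⟩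
  have hφb : ∀ p, φ (basePt P H p) = basePt P K₀ p := fun p => rfl
  have hφ'b : ∀ p, φ' (basePt P H' p) = basePt P K₀' p := fun p => rfl
  have hι₀ : Set.range (basePt P K₀) = ecl (∅ : Set K₀) := range_comp_basePt_eq hι φ hφ
  have hι₀' : Set.range (basePt P K₀') = ecl (∅ : Set K₀') := range_comp_basePt_eq hι' φ' hφ'
  have hι₀p : ∀ p, basePt P K₀ p ∈ ecl (∅ : Set K₀) := fun p => hι₀ ▸ ⟨p, rfl⟩
  have hιp : ∀ p, basePt P H p ∈ ecl (∅ : Set H) := fun p => hι ▸ ⟨p, rfl⟩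
  have hP := isPregeometry_ecl H
  have hg : IsPartialEmbOn (Language.eclIsoOver P) g G := hxx'.isPartialEmbOn
  obtain ⟨gK, hgK, hGK, himg, -⟩ := exists_pushforward_over φ hφ hφb φ' hφ' hφ'b hG hg
  have hK := eqQFTypeOver₂_pushforward_over φ hφ hφb φ' hφ' hφ'b hgK hxx'
  have hKu : ¬ (Set.univ : Set K₀).Countable := fun h =>
    (Cardinal.aleph0_lt_mk_iff.1 hK₀u).not_countable (Set.countable_univ_iff.1 h)
  have hK'u : ¬ (Set.univ : Set K₀').Countable := fun h =>
    (Cardinal.aleph0_lt_mk_iff.1 hK₀'u).not_countable (Set.countable_univ_iff.1 h)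
  -- `φ y ∈ ecl (φ G ∪ φ x)`
  have hyK : φ y ∈ ecl (φ '' G ∪ Set.range (⇑φ ∘ x)) := by
    rw [Set.range_comp, ← Set.image_union, ← image_ecl_of_closedEmb φ hφ]
    exact Set.mem_image_of_mem φ hy
  have hxxK : ∀ ⦃k : ℕ⦄ (a : Fin k → K₀), (∀ i, a i ∈ φ '' G) →
      EclIsoOver (basePt P K₀) (basePt P K₀') (Fin.append a (⇑φ ∘ x)) (Fin.append (gK ∘ a) (⇑φ' ∘ x')) :=
    fun k a ha => eclIsoOver_of_eqQFType₂ hι₀p (hK a ha)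
  obtain ⟨yK, hyK'⟩ := ZilberTransfer.exists_eclIsoOver_append_snoc hK₀ hK₀' hKu hK'u hι₀ hι₀'
    (hGc.image φ) hGK hxxK hyK
  have hyK'' : (Language.eclIsoOver P).EqQFTypeOver₂ (φ '' G) gK
      (Fin.snoc (⇑φ ∘ x) (φ y) : Fin (n + 1) → K₀) (Fin.snoc (⇑φ' ∘ x') yK) := fun k a ha =>
    eqQFType₂_of_eclIsoOver hι₀p (hyK' a ha)
  -- `yK` lies in the image of `φ'`: finite support of `y` inside `G`
  obtain ⟨A₀, hA₀, hA₀fin, hyA₀⟩ := hP.finite_character hy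
  obtain ⟨m, σ, hσ⟩ := (hA₀fin.inter_of_left G).fin_embedding
  have hσG : ∀ i, σ i ∈ G := fun i => ((hσ ▸ Set.mem_range_self i : σ i ∈ A₀ ∩ G)).2
  have hyσ : y ∈ ecl (Set.range (Fin.append (σ : Fin m → H) x)) := by
    refine hP.mono ?_ hyA₀
    intro c hc
    rw [range_append]
    rcases hA₀ hc with hcG | hcx
    · exact Or.inl (hσ ▸ ⟨hc, hcG⟩ : c ∈ Set.range σ)
    · exact Or.inr hcx
  have key := hyK'' (⇑φ ∘ σ) fun i => Set.mem_image_of_mem φ (hσG i)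
  rw [Fin.append_snoc, Fin.append_snoc] at key
  have hyK₁ : φ y ∈ ecl (Set.range (Fin.append (⇑φ ∘ σ) (⇑φ ∘ x))) := by
    rw [← comp_append', Set.range_comp, ← image_ecl_of_closedEmb φ hφ]
    exact Set.mem_image_of_mem φ hyσ
  have hyK₂ := (mem_ecl_range_iff_of_eqQFType₂_snoc_over hι₀p key).1 hyK₁
  have hsub : Set.range (Fin.append (gK ∘ (⇑φ ∘ σ)) (⇑φ' ∘ x')) ⊆ Set.range φ' := by
    rw [range_append]
    rintro z (⟨i, rfl⟩ | ⟨i, rfl⟩)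
    · exact ⟨g (σ i), (hgK (σ i)).symm⟩
    · exact ⟨x' i, rfl⟩
  have hyK₃ : yK ∈ Set.range φ' := by
    rw [← hφ']
    exact ecl_subset_ecl_of_subset (hsub.trans (subset_ecl _)) hyK₂
  obtain ⟨y', rfl⟩ := hyK₃
  refine ⟨y', eqQFTypeOver₂_of_pushforward_over φ hφ hφb φ' hφ' hφ'b hgK ?_⟩
  rwa [Fin.comp_snoc, Fin.comp_snoc]

/-- **Axiom (4i) over `∅` for `ZilberClosedClassOver P`**: points outside `ecl(∅)` in two members
have the same quantifier-free type — the case `G = ecl(∅)` of `eqQFTypeOver₂_of_notMem_of_closed`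
along the isomorphism `ι_{H'} ∘ ι_H⁻¹ : ecl^H(∅) ≅ ecl^{H'}(∅)` (a partial embedding on `ecl(∅)`,
`eclIsoOver_elim0` with `EclIsoOver.extend`). [cite: Haykazyan2016, Definition 2] -/
theorem eqQFType₂_of_notMem_cl_empty (hH : ZilberClosedClassOver P H cl)
    (hH' : ZilberClosedClassOver P H' cl') ⦃x : H⦄ ⦃x' : H'⦄ (hx : x ∉ cl ∅) (hx' : x' ∉ cl' ∅) :
    (Language.eclIsoOver P).EqQFType₂ ![x] ![x'] := by
  classical
  obtain ⟨iF, iCZ, iE, iB, rfl, rfl, hι, hrest⟩ := id hH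
  obtain ⟨iF', iCZ', iE', iB', rfl, rfl, hι', hrest'⟩ := id hH'
  obtain ⟨K₀, iFK, iCK, iEK, hK₀, -, φ, hφ⟩ := hrest
  have hιp : ∀ p, basePt P H p ∈ ecl (∅ : Set H) := fun p => hι ▸ ⟨p, rfl⟩
  have hι'inj : Function.Injective (basePt P H') := (basePt P H').toRingHom.injective
  have hιinj : Function.Injective (basePt P H) := (basePt P H).toRingHom.injective
  -- the map `ι_{H'} ∘ ι_H⁻¹` on `ecl ∅`, junk elsewhere
  let g : H → H' := fun z => if hz : ∃ p, basePt P H p = z then basePt P H' (Classical.choose hz) else x'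
  have hg : ∀ p, g (basePt P H p) = basePt P H' p := by
    intro p
    have hz : ∃ q, basePt P H q = basePt P H p := ⟨p, rfl⟩
    simp only [g, dif_pos hz]
    congr 1
    exact hιinj (Classical.choose_spec hz)
  have hgG : g '' ecl (∅ : Set H) = ecl (∅ : Set H') := by
    rw [← hι, ← hι']
    ext b
    constructor
    · rintro ⟨_, ⟨p, rfl⟩, rfl⟩; exact ⟨p, (hg p).symm⟩
    · rintro ⟨p, rfl⟩; exact ⟨basePt P H p, ⟨p, rfl⟩, hg p⟩
  -- `g` is a partial embedding on `ecl ∅`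
  have h0 := eclIsoOver_elim0 hι hι'
  have hgemb : IsPartialEmbOn (Language.eclIsoOver P) g (ecl ∅) := by
    intro k a ha
    obtain ⟨v', hv', -, hvb, -⟩ := h0.extend a
      (fun j => by rw [Set.range_eq_empty Fin.elim0]; exact ha j) (fun i => i.elim0)
    have e : v' = g ∘ a := by
      funext j
      obtain ⟨p, hp⟩ : a j ∈ Set.range (basePt P H) := hι.symm ▸ ha j
      rw [Function.comp_apply, ← hp, hg p]
      exact hvb j p hp.symm
    rw [← e]
    exact eqQFType₂_of_eclIsoOver hιp hv'
  have hGc : (ecl (∅ : Set H)).Countable := by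
    have h1 : (φ '' ecl (∅ : Set H)).Countable := by
      rw [image_ecl_of_closedEmb φ hφ]
      exact hK₀.hasCountableClosureProperty _ ((Set.finite_empty.image _).countable)
    exact Set.countable_of_injective_of_countable_image φ.toRingHom.injective.injOn h1
  have key := eqQFTypeOver₂_of_notMem_of_closed hH hH' (ecl ∅) g hGc (Khovanskii.ecl_ecl _)
    (by rw [hgG]; exact Khovanskii.ecl_ecl _) hgemb (x := x) (x' := x')
    (by rwa [Khovanskii.ecl_ecl]) (by rwa [hgG, Khovanskii.ecl_ecl])
  exact key.eqQFType₂

end Homogeneity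

/-! ### Assembly -/

/-- **The class of closed E-subfields of uncountable Zilber fields over the base `P` is a
quasiminimal pregeometry class** (Haykazyan's Def. 2, with axiom II across two members): closure
under isomorphism, pregeometry and countable closure, closed subsets are members, closure
determined by partial embeddings, the same quantifier-free sentences, and `ℵ₀`-homogeneity over
`∅` and over countable closed subsets across two members — all proved (the last by
`ZilberHomogeneityTransfer.lean`, Bays–Kirby 2013 Prop. 5 via the countable model).
[cite: Haykazyan2016, Definition 2] [cite: BaysKirby2013Excellence, Props 4–5] -/
theorem isQuasiminimalPregeometryClass :
    IsQuasiminimalPregeometryClass (Language.eclIsoOver P) (ZilberClosedClassOver P) where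
  of_equiv hH e := hH.of_equiv e
  eqQFType₂_elim0 hH hH' := eqQFType₂_elim0 hH hH'
  isPregeometry hH := hH.isPregeometry
  countable_cl hH := hH.countable_cl
  cl_mem hH := hH.cl_mem
  mem_cl_iff_of_isPartialEmbOn hH hH' := hH.mem_cl_iff_of_isPartialEmbOn hH'
  eqQFType₂_of_notMem_cl_empty hH hH' := eqQFType₂_of_notMem_cl_empty hH hH'
  exists_eqQFType₂_snoc hH hH' := exists_eqQFType₂_snoc hH hH'
  eqQFTypeOver₂_of_notMem_of_closed hH hH' := eqQFTypeOver₂_of_notMem_of_closed hH hH'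
  exists_eqQFTypeOver₂_snoc_of_closed hH hH' := exists_eqQFTypeOver₂_snoc_of_closed hH hH'

end ZilberClosedClassOver

/-! ### Zilber's categoricity theorem -/

/-- **Zilber's categoricity theorem** (Zilber 2005, Thm 1.1; Bays–Kirby 2018, Thm 1.2 = Thm 9.1;
Bays–Kirby 2013, Thm 1): **two Zilber fields of the same uncountable cardinality are isomorphic
exponential fields** — the named fact `zilber_categoricity` HOLDS. Proof: with `P = ecl^K(∅)` and
base points `ecl^K(∅) ↪ K`, `ecl^K(∅) ≅ ecl^{K'}(∅) ↪ K'` (`ZilberPrimeModel.exists_eHom_eclEmpty`,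
Kirby 2013 Cor. 6.10), both fields are uncountable members of the quasiminimal pregeometry class
`ZilberClosedClassOver P` (`ZilberClosedClassOver.isQuasiminimalPregeometryClass`: Bays–Kirby 2013
Props 4–5 / Bays–Kirby 2018 Thms 6.9, 8.2 for the class axioms), whose uncountable members of equal
cardinality are isomorphic (Kirby 2010 Thm 3.3 / Haykazyan 2016 Thm 16:
`IsQuasiminimalPregeometryClass.nonempty_equiv_of_mk_eq'`), and an isomorphism of
`Language.eclIsoOver P`-structures is an isomorphism of exponential rings.
[cite: Zilber2005PseudoExp, Thm 1.1] [cite: BaysKirby2018ANT, Thm 9.1]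
[cite: BaysKirby2013Excellence, Thm 1] [cite: Haykazyan2016, Theorem 16]
[cite: Kirby2010QMEC, Thm 3.3] -/
theorem zilber_categoricity_holds : zilber_categoricity := by
  intro K K' _ _ _ _ _ _ hK hK' hcard hunc
  classical
  haveI : Uncountable K := aleph0_lt_mk_iff.1 hunc
  have hunc' : ℵ₀ < #K' := hcard ▸ hunc
  -- the base: the prime model of `K`
  obtain ⟨ι', hι'⟩ := ZilberPrimeModel.exists_eHom_eclEmpty hK hK'
  letI : EclBasePoint (Khovanskii.eclSubfield (∅ : Set K)) K := ⟨Khovanskii.eclSubfield.eHom ∅⟩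
  letI : EclBasePoint (Khovanskii.eclSubfield (∅ : Set K)) K' := ⟨ι'⟩
  have hι : Set.range (basePt (Khovanskii.eclSubfield (∅ : Set K)) K) = ecl (∅ : Set K) := by
    ext a
    constructor
    · rintro ⟨b, rfl⟩; exact b.2
    · intro ha; exact ⟨⟨a, ha⟩, rfl⟩
  have h𝒞 := ZilberClosedClassOver.isQuasiminimalPregeometryClass (P := Khovanskii.eclSubfield (∅ : Set K))
  obtain ⟨e⟩ := h𝒞.nonempty_equiv_of_mk_eq'
    (zilberClosedClassOver_of_isZilberField hK hunc hι)
    (zilberClosedClassOver_of_isZilberField hK' hunc' hι') hcard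
  exact ⟨ExponentialRingEquiv.ofEclIsoOverEquiv e⟩

end Literature.NumberTheory.Transcendental

end
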